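import Summits.CriticalPhenomena.PercolationContinuityZ3.Theorems.Transplant.FKConnectivityAllQAntipodalRootForm3BaseParMain
import Summits.CriticalPhenomena.PercolationContinuityZ3.Theorems.Transplant.FKConnectivityAllQAntipodalRootFormParBox
import Summits.CriticalPhenomena.PercolationContinuityZ3.Theorems.Transplant.FKConnectivityAllQAntipodalRootFormGenTransfer

/-!
# Connectivity correlation inequalities for `φ_{w,q}` — ROOT-FORM CALCULUS, file 73e: FACT 2 of the parallel 2+1 gluing `E₁ ∥ B`
# (the parallel transform of `E₁ ∥ B` is `E₁ ∥ (B ∥ g)`, so fact 2 is fact 1 for the box `parBox B`)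

Support file (`--supports stmt-CriticalPhenomena-4575`), FK sub-lane `prim-bschramm-fk-2` (gen 32); builds on p205010 (kernel theorem, internal audit
signed; external expert review pending).  No definitions, no named facts, no sorries; standard axioms.  Memo FROM-fk-2-g31-DUALITY.md §9 (ii),
FROM-fk-2-g32-*.md.

`Base3.gcombPar_gMt_nonneg` (file 73d) is fact 1 of the three-special environment `E₁ ∥ B`.  Fact 2 asks the same for its parallel transform
`Gen.parE (gcombPar E₁ B)` (a fresh parallel edge `g` between the poles).  Instead of commuting `g` into `E₁` (memo §9 (ii)), attach it to the BOX:
configuration by configuration `g ∥ (E₁ ∥ B) = E₁ ∥ (B ∥ g)` (`gcombPar_parBox`, from `comb3_parS`), and `B ∥ g = parBox B` (file 61t) satisfies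
the box axioms (`parBox_consistent/_A1/_A3n/_A4n`), so fact 2 is file 73d again, transported along the order isomorphism
`C₁ × (Bool × C_B) ≃ Bool × (C₁ × C_B)` (`Gen.gtransfer_Mt`, level shift `0`): `Base3.gcombPar_parE_gMt_nonneg`, with exactly the hypotheses of 73d.
[folklore]
-/

noncomputable section

namespace Summit.CriticalPhenomena.PercolationContinuityZ3.Theorems

namespace FK

namespace RootForm

namespace Base3

open Finset Base Gen Cert3

/-- a parallel edge attached to the box commutes into the composite datum. [folklore] -/
theorem comb3_parS (a : PDat) (z : SDat) (b : Bool) : comb3 a (z.parS b) = (comb3 a z).par b := by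
  obtain ⟨l, k1, k2⟩ := a; obtain ⟨L, c, cb⟩ := z
  cases b <;> cases k1 <;> cases k2 <;> cases c <;> cases cb <;> simp [comb3, SDat.parS, PDat.par] <;> omega

/-- the states of `B ∥ g`. [folklore] -/
theorem parBox_ts {C_B : Type*} (B : C_B → BDat) (b : Bool) (γ : C_B) (s : Bool) :
    (parBox B (b, γ)).ts s = ((B γ).ts s).parS b := by
  cases s <;> rfl

/-- **`g ∥ (E₁ ∥ B) = E₁ ∥ (B ∥ g)`** at the level of pattern data. [folklore] -/
theorem gcombPar_parBox {C₁ C_B : Type*} (E₁ : Env C₁) (B : C_B → BDat) (β : C₁) (b : Bool) (γ : C_B) :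
    gcombPar E₁ (parBox B) (β, (b, γ)) = Gen.parE (gcombPar E₁ B) (b, (β, γ)) := by
  show (⟨fun P => comb3 (dq (E₁ β) (qOf P)) ((parBox B (b, γ)).ts (decide ((2 : Fin 3) ∈ P)))⟩ : Gen.EDat (Fin 3)) =
    ⟨fun P => (comb3 (dq (E₁ β) (qOf P)) ((B γ).ts (decide ((2 : Fin 3) ∈ P)))).par b⟩
  congr 1
  funext P
  rw [parBox_ts, comb3_parS]

section Main

variable {C₁ C_B : Type*} [Fintype C₁] [Fintype C_B] [Preorder C₁] [Preorder C_B]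

/-- **FACT 2 of `E₁ ∥ B` (GLUE(2,1)∥, parallel transform)** from the same hypotheses as fact 1 (file 73d). [folklore] -/
theorem gcombPar_parE_gMt_nonneg (E₁ : Env C₁) (B : C_B → BDat)
    (hcE : ∀ β, consistentP (ptype (E₁ β)) = true) (hcB : ∀ γ, Cert.consistentB (B γ).type = true)
    (hF1 : ∀ h0 h1 : C₁ → ℝ, Monotone h0 → Monotone h1 → (∀ β, 0 ≤ h0 β) → (∀ β, h0 β ≤ h1 β) → ∀ K : ℤ, 0 ≤ Mt E₁ h0 h1 K)
    (hF2 : ∀ h0 h1 : C₁ → ℝ, Monotone h0 → Monotone h1 → (∀ β, 0 ≤ h0 β) → (∀ β, h0 β ≤ h1 β) → ∀ K : ℤ,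
      0 ≤ Mt (parE E₁) (fun p => h0 p.2) (fun p => h1 p.2) K)
    (hF4 : ∀ h : C₁ → ℝ, Monotone h → (∀ β, 0 ≤ h β) → ∀ K : ℤ, 0 ≤ ∑ β, h β * (E₁ β).andCon K)
    (hUy : ∀ h0 h1 : C₁ → ℝ, Monotone h0 → Monotone h1 → (∀ β, 0 ≤ h0 β) → (∀ β, h0 β ≤ h1 β) → ∀ K : ℤ,
      0 ≤ ∑ β, (h0 β * ((E₁ β).d0.acon K - (E₁ β).dy.acon K) + h1 β * ((E₁ β).dz.acon K - (E₁ β).dyz.acon K)))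
    (hUz : ∀ h0 h1 : C₁ → ℝ, Monotone h0 → Monotone h1 → (∀ β, 0 ≤ h0 β) → (∀ β, h0 β ≤ h1 β) → ∀ K : ℤ,
      0 ≤ ∑ β, (h0 β * ((E₁ β).d0.acon K - (E₁ β).dz.acon K) + h1 β * ((E₁ β).dy.acon K - (E₁ β).dyz.acon K)))
    (hXy : ∀ l0 h0 l1 h1 : C₁ → ℝ, Monotone l0 → Monotone h0 → Monotone l1 → Monotone h1 → (∀ β, 0 ≤ l0 β) → (∀ β, l0 β ≤ h0 β) →
      (∀ β, l1 β ≤ h1 β) → (∀ β, l0 β ≤ l1 β) → (∀ β, h0 β ≤ h1 β) → ∀ K : ℤ,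
      0 ≤ ∑ β, (h0 β * ((E₁ β).dy.r1 K - (E₁ β).dy.r2 K) + l0 β * ((E₁ β).d0.r1 K - (E₁ β).d0.r2 K)
        + h1 β * ((E₁ β).dyz.r1 K - (E₁ β).dyz.r2 K) + l1 β * ((E₁ β).dz.r1 K - (E₁ β).dz.r2 K)))
    (hB1 : ∀ h : C_B → ℝ, Monotone h → (∀ γ, 0 ≤ h γ) → ∀ K : ℤ, 0 ≤ ∑ γ, h γ * gA1 (B γ) K)
    (hB3 : ∀ h0 h1 : C_B → ℝ, Monotone h0 → Monotone h1 → (∀ γ, 0 ≤ h0 γ) → (∀ γ, h0 γ ≤ h1 γ) → ∀ K : ℤ,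
      0 ≤ ∑ γ, (h1 γ * gA3u (B γ) K + h0 γ * gA3l (B γ) K))
    (hB4 : ∀ h0 h1 : C_B → ℝ, Monotone h0 → Monotone h1 → (∀ γ, 0 ≤ h0 γ) → (∀ γ, h0 γ ≤ h1 γ) → ∀ K : ℤ,
      0 ≤ ∑ γ, (h1 γ * gA4u (B γ) K + h0 γ * gA4l (B γ) K))
    {H0 H1 : Bool × (C₁ × C_B) → ℝ} (m0 : Monotone H0) (m1 : Monotone H1) (n0 : ∀ p, 0 ≤ H0 p) (le : ∀ p, H0 p ≤ H1 p) (J : ℤ) :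
    0 ≤ gMt (Gen.parE (gcombPar E₁ B)) H0 H1 J := by
  -- fact 1 for `E₁ ∥ (B ∥ g)`
  have base : ∀ h0 h1 : C₁ × (Bool × C_B) → ℝ, Monotone h0 → Monotone h1 → (∀ p, 0 ≤ h0 p) → (∀ p, h0 p ≤ h1 p) → ∀ K : ℤ,
      0 ≤ gMt (gcombPar E₁ (parBox B)) h0 h1 K := fun h0 h1 m0' m1' n0' le' K =>
    gcombPar_gMt_nonneg E₁ (parBox B) hcE (parBox_consistent B hcB) hF1 hF2 hF4 hUy hUz hXy
      (fun h mh nh K => parBox_A1 B hB1 h mh nh K) (fun h0 h1 m0 m1 n0 le K => parBox_A3n B hB1 hB3 h0 h1 m0 m1 n0 le K)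
      (fun h0 h1 m0 m1 n0 le K => parBox_A4n B hB4 h0 h1 m0 m1 n0 le K) m0' m1' n0' le' K
  -- transport along `(β, (b, γ)) ↦ (b, (β, γ))`
  let ψ : C₁ × (Bool × C_B) ≃ Bool × (C₁ × C_B) :=
    { toFun := fun p => (p.2.1, (p.1, p.2.2)), invFun := fun q => (q.2.1, (q.1, q.2.2)), left_inv := fun _ => rfl, right_inv := fun _ => rfl }
  have hψ : Monotone ψ := fun p q h =>
    Prod.mk_le_mk.2 ⟨(Prod.mk_le_mk.1 (Prod.mk_le_mk.1 h).2).1, Prod.mk_le_mk.2 ⟨(Prod.mk_le_mk.1 h).1, (Prod.mk_le_mk.1 (Prod.mk_le_mk.1 h).2).2⟩⟩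
  refine Gen.gtransfer_Mt (E := gcombPar E₁ (parBox B)) (E' := Gen.parE (gcombPar E₁ B)) (φ := ψ) (κ := 0) hψ ?_ base H0 H1 m0 m1 n0 le J
  rintro ⟨β, b, γ⟩ K
  rw [sub_zero, show ψ (β, b, γ) = (b, (β, γ)) from rfl, ← gcombPar_parBox]
  exact ⟨rfl, rfl⟩

end Main

end Base3

end RootForm

end FK

end Summit.CriticalPhenomena.PercolationContinuityZ3.Theorems

end
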